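import Literature.MathematicalPhysics.QuantumFieldTheory.Balaban1983to89.B9SectBCodedCarrierPullbacks
import Literature.MathematicalPhysics.QuantumFieldTheory.Balaban1983to89.B9SectBCodedChainR4
import Literature.MathematicalPhysics.QuantumFieldTheory.Balaban1983to89.B9SectBCodedClassGY
import Literature.MathematicalPhysics.QuantumFieldTheory.Balaban1983to89.B9BackgroundsKLevelV1R
import Literature.MathematicalPhysics.QuantumFieldTheory.Balaban1983to89.Node00.CarriersYP

/-!
# NODE 00 (YM-PLAN Track A) — STAGE 3′(Y) OF THE CARRIERS OF RECORD OVER THE CLASS-PARAMETRIC CODED CARRIER: `carriersYU`, `Y9OfRecordU` (SOCKET road (α), piece (α2))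

Cell `pub-ymgap`, seat `pub-ymgap-node00-def-Y` (g27), def-Y FILE 68 = the CODED-CARRIER SIBLING of `Node00/CarriersYP.lean` (`Y9OfRecordP θ Mstar ops := carriersYP … ops`),
typed from dag-n06-d g17's spec `CarriersYU.spec.lean` (SOCKET-(α) PLAN, fleet INBOX 2026-08-29 l.46481 ∕ l.46497) over dag-n06-c's CLASS-PARAMETRIC coded carrier
(`B9SectBCodedClassR`: a parameter `P : RegExtraY …` = the cube conditions of (3.35) ∕ (3.36) as predicate families, the member carrier
`bg9YC 𝔸 G P x := bg9YR 𝔸 G (regC335 𝔸 G P) (regC336 𝔸 G P) x` of MODULE 3-R) and dag-n06-d's pull-backs `B9SectBCodedCarrierPullbacks` ((α1)); keyed ONCE over the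
parametric carrier (director-ym №282 (B), 2026-08-29).  APPEND-ONLY: a NEW importing module; `CarriersYP`, `OpsY`, every `…OfRecordV4∕V6∕V7` record and every consumer untouched.

WHAT.  [Balaban1985BackgroundPropagators] Theorem 3.4 (p. 400) extends the operators of Theorem 3.1 «as analytic functions of A» through the complex
configurations `U′U`, `U′ = e^{iηA′}` of the classes (3.37)–(3.38) (p. 396), for `U` in the cube class (3.35) («O(1) … a number ≧ 10», p. 396).  dag-n06-c typed that
extension over a CODED carrier: the backgrounds record `(codingYx P G x C37 C38).bg` (`B9SectBGpFrameCodedYR`) whose configurations are the codes `base U ∣ mult a ∣ prod U a`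
decoding to `U ∣ U′ ∣ U′U`, whose (3.35) ∕ (3.36) are the PARAMETER's `(«U is G-valued» ∧ P.P₁) ∧ P.P₂` ∕ `(… ∧ P.Q₁) ∧ P.Q₂` on the base codes, with the U-LETTER readings of
`G′ = (Δ′_A)⁻¹` and `G = (Δ_A)⁻¹` (`KSCU ∕ KACU`, namespace `B9SectBCodedReadingsUR` of dag-n06-c's bundle `B9SectBCodedChainR3`: NODE 00's letters at the BASE of a code, the operator at its DECODING) and the analyticity slot `IsAnKY`
(namespace `B9SectBCodedChainAnR` of bundle `B9SectBCodedChainR2`); the U-letter Sect.-B step is PROVED there on subfamilies with sections (dag-n06-c ∕ dag-n06-d).  The N06 certificate of record concludes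
`B9LeafX (Y9OfRecordP …)` over the RECORD carrier `bg9YP`; FLAG №8's Summits half asks for the junction.  Road (α) (dag-n06-d I.46230 ∕ I.46481): re-conclude the
certificate over a coded-carrier LEAF OF RECORD — this module's bundle, at the class instance the planner names ((α3), dag-n06-d).

CONTENTS.  §1 `cqY d = 4(d+1)e^{3(d+1)/2}` (the extended-class constant of `C37GY`, [B9] (3.37) p. 396 with dag-n06-c's `Cq`) and the per-index coding
`codingYU P G f ιB C38 j := codingYx P G (f j) (C37GY G (f j) (ιB j) (cqY d)) (C38 j) : Coding (bg9YC 𝔸 G P (f j))`; §2 ★★★ `carriersYU P G f b ιB C38 ops : PrintedCarriers9X`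
on a subfamily `f : J → MemberY …` with block sections `ιB` and a real basis `b` of the fibre: index `J`; geometry, `InCube`, `dOmega`, `inΛ`, `unitDist`, `OmK`, `c35`, `d9` =
the record's along `f`; backgrounds `bg9 j := (codingYU … j).bg`; `Gp ∕ GA := KSCU P … parSymY ∕ KACU P … (GAY … parSymY parBY (GpY … parSymY)) parBY`;
`Cinv := pullS … (CinvY P f G parSymY j)` — the class-parametric (3.48) kernel of `C = CY parSymY (GpY parSymY)` BY NAME (namespace `B9SectBKerFrameCodedYR` of bundle
`B9SectBCodedChainR4`), with its `siteKernelOfOp` reading as an `rfl` face; `IsAnalyticExt := IsAnKY P … b …`; every other operator field of `ops (f j)` (a record over `bg9Y 𝔸 G (f j)`) FIRST RE-TYPED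
fieldwise over `bg9YC 𝔸 G P (f j)` by MODULE 3-R (`kernelFamilyR ∕ siteKernelR ∕ fineKernelR ∕ rwExpansionR ∕ rwKernelExpansionR ∕ hKernelR`; the contravariant slots
through `kernelFamilyRY ∕ hKernelRY`; configuration predicates unchanged — exactly as `B9PinCarriersKLevelV1R.carriersYR`) THEN READ ALONG THE DECODING (`pullRW ∕ pullRWK ∕
pullC ∕ pullK ∕ pullH ∕ pullPK ∕ pullPH ∕ pullPK₀ ∕ pullS ∕ pullF`); §2a one `rfl` projection lemma per field; §2b «at a base code the pulled-back carrier reads the record's at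
`U`» (`rfl`: `Coding.dec (base U) = U`); §2c the classes of the coded carrier at a base code UNFOLDED (`Iff.rfl`): (3.35) ∕ (3.36) read the parameter's conjunctions, (3.37) ∕
(3.38) between a base and a multiplier code read `C37GY … (cqY d)` ∕ `C38 j`, no multiplier or product code is (3.35)-regular; §3 ★★ AT THE RECORD (`M_N(ℂ)`, `SU(N)`, the
Stage-3 dictionary `θ`), generic in the class parameter: `Y9OfRecordU N θ Mstar P ops f b ιB C38 := carriersYU P (specialUnitaryUnits (Fin N)) f b ιB C38 ops`, its projections,
`Y9OfRecordU_nonempty_I9`, §3a the agreement of its geometric fields with `Y9OfRecordP`'s along `f`; §3b the instance at THE RECORD's READING OF PRINT's CLASS,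
`Y9OfRecordUPb … := Y9OfRecordU N θ Mstar (extraYPb (M_N ℂ) SU(N)) …` (dag-n06-c: `P₁ ∕ Q₁` = «`0 ≤ α₀`» ∧ print's cube condition at «O(1) = 10» (`c35Y`) at the member's
index, `P₂ ∕ Q₂` = MODULE 2-P's field at the second pin; `regC335 … extraYPb` IS `B9BackgroundsKLevelV1Pb.regYPb335` up to the order of conjuncts —
`B9SectBCodedClassR.classIncl_regC335Pb_regYPb335 ∕ classIncl_regYPb335_regC335Pb`; director-ym №282 (B) «at `R₁ := regYPb335`»), with its (3.35) ∕ (3.36) faces spelled out.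
At `P := extraY 𝔸 G` the bundle is the one over MODULE 3's reading (`bg9Y 𝔸 G x = bg9YC 𝔸 G (extraY 𝔸 G) x`, `B9SectBCodedClassR.bg9Y_eq_bg9YC`, `rfl`).

HONEST FRAMING.  Definitions + kernel bookkeeping (`rfl` ∕ `Iff.rfl`, projections); NO estimate, no theorem of [B9] asserted or proved; the leaf `B9LeafX (Y9OfRecordU … P …)`
is an OPEN obligation at every `P` exactly as over `Y9OfRecordP` (closable today only from displayed hypotheses); which carrier and which class instance the N06 sentence of
record is concluded over is the planner's ruling (road (α) ∕ (β) ∕ (γ); (α3) is dag-n06-d's), not this file's — `Y9OfRecordUPb` NAMES the record's reading of print's class and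
asserts nothing about it; the v1 located caveat (coded carrier typed over MODULE 3's small-cube class only) is answered by the parameter, not by a theorem; N06 NOT discharged;
FLAG №8 untouched; counts unmoved; one finite 𝕋⁴ programme at fixed ε — NOT continuum ∕ OS ∕ mass gap ∕ Clay.  No `sorry`, `axiom`, `instance`, `notation`.
-/

noncomputable section

namespace Literature.MathematicalPhysics.QuantumFieldTheory.Balaban1983to89.Node00

open DagBinding (PrintedCarriers9X)
open B9PinCarriersKLevelV1 (OperatorLayerY)
open B9PinMembersKLevelV1 (MemberY geo9Y bg9Y)
open B9BackgroundsKLevelV1P (bg9KP)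
open B9BackgroundsKLevelV1R (bg9YR kernelFamilyR kernelFamilyRY siteKernelR fineKernelR rwExpansionR rwKernelExpansionR hKernelR hKernelRY)
open B9SectBCodedClassR (RegExtraY regC335 regC336 bg9YC extraY extraYPb)
open B9SectBGpLettersY (GVal)
open B9PinGeometryKLevelV1 (dOmegaY OmKY inΛY unitDistY InCubeY c35Y)
open B9Eq360DeltaPrimeAY (AfldY)
open B9SectBCodedCarrier (CCfg Coding pullK pullS)
open B9SectBCodedCarrierPullbacks (pullF pullH pullRW pullRWK pullC pullPK pullPH pullPK₀)
open B9SectBGpFrameCodedYR (codingYx)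
open B9SectBCodedReadingsUR (KSCU KACU)
open B9SectBCodedChainAnR (IsAnKY)
open B9SectBKerFrameCodedYR (CinvY)
open B6Ineq2142KLevelV1 (β)
open B9SectBCodedClassGY (C37GY)
open B7Prop2SpecialUnitary (specialUnitaryUnits)
open scoped Matrix.Norms.L2Operator

/-! ## §1. The extended-class constant and the per-index coding -/

section Coding

variable {d ℓ : ℕ} {hd : 1 ≤ d + 1} {hL : Odd (ℓ + 1) ∧ 1 < ℓ + 1} {b₀ b₁ : ℝ} {Mstar : ℕ}
variable {𝔸 : Type} [NormedRing 𝔸] [NormedAlgebra ℂ 𝔸] [CompleteSpace 𝔸] (P : RegExtraY d ℓ hd hL b₀ b₁ Mstar 𝔸) (G : Subgroup 𝔸ˣ)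
  {J : Type} (f : J → MemberY d ℓ hd hL b₀ b₁ Mstar)
  (ιB : ∀ j : J, BlkY (f j).toKIdx → IBondY (f j).toKIdx) (C38 : ∀ j : J, ℝ → CfgY 𝔸 (f j).toKIdx → AfldY 𝔸 (f j).toKIdx → Prop)

/-- **THE EXTENDED-CLASS CONSTANT `Cq = 4(d+1)e^{3(d+1)/2}`** of dag-n06-c's class `C37GY` in lattice dimension `d + 1` (the constant at which `B9SectBCodedClassGY` closes the
coded class (3.37) under the Sect.-B step). [cite: Balaban1985BackgroundPropagators, (3.37) p.396, dictionary] -/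
def cqY (d : ℕ) : ℝ := 4 * ((d : ℝ) + 1) * Real.exp (3 * (((d : ℝ) + 1) / 2))

/-- `cqY` unfolded (`rfl`). [cite: Balaban1985BackgroundPropagators, (3.37) p.396, bookkeeping] -/
theorem cqY_eq (d : ℕ) : cqY d = 4 * ((d : ℝ) + 1) * Real.exp (3 * (((d : ℝ) + 1) / 2)) := rfl

/-- `0 ≤ Cq`. [cite: Balaban1985BackgroundPropagators, (3.37) p.396, bookkeeping] -/
theorem cqY_nonneg (d : ℕ) : 0 ≤ cqY d := by unfold cqY; positivity

/-- `0 < Cq`. [cite: Balaban1985BackgroundPropagators, (3.37) p.396, bookkeeping] -/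
theorem cqY_pos (d : ℕ) : 0 < cqY d := by unfold cqY; positivity

/-- **THE CODING OF THE MEMBER `f j`'S CLASS-PARAMETRIC BACKGROUNDS `bg9YC 𝔸 G P (f j)` AT THE EXTENDED CLASS**: dag-n06-c's `codingYx P` at `C37GY … (cqY d)` and the
parameter class `C38 j`.
[cite: Balaban1985BackgroundPropagators, (3.37)–(3.38) p.396, dictionary] -/
def codingYU (j : J) : Coding (bg9YC 𝔸 G P (f j)) := codingYx P G (f j) (C37GY G (f j) (ιB j) (cqY d)) (C38 j)

/-- `codingYU` unfolded (`rfl`). [cite: Balaban1985BackgroundPropagators, (3.37) p.396, bookkeeping] -/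
theorem codingYU_eq (j : J) : codingYU P G f ιB C38 j = codingYx P G (f j) (C37GY G (f j) (ιB j) (cqY d)) (C38 j) := rfl

/-- the (3.37) class of the coding is the extended class at `Cq`. [cite: Balaban1985BackgroundPropagators, (3.37) p.396, bookkeeping] -/
theorem codingYU_C37 (j : J) : (codingYU P G f ιB C38 j).C37 = C37GY G (f j) (ιB j) (cqY d) := rfl

/-- the (3.38) class of the coding is the parameter `C38 j`. [cite: Balaban1985BackgroundPropagators, (3.38) p.396, bookkeeping] -/
theorem codingYU_C38 (j : J) : (codingYU P G f ιB C38 j).C38 = C38 j := rfl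

/-- a base code decodes to its configuration (`rfl`). [cite: Balaban1985BackgroundPropagators, (3.37) p.396, bookkeeping] -/
theorem codingYU_dec_base (j : J) (U : CfgY 𝔸 (f j).toKIdx) : (codingYU P G f ιB C38 j).dec (.base U) = U := rfl

end Coding

/-! ## §2. The [B9] carrier bundle over the coded carrier, as a function of the operator layer -/

section Bundle

variable {d ℓ : ℕ} {hd : 1 ≤ d + 1} {hL : Odd (ℓ + 1) ∧ 1 < ℓ + 1} {b₀ b₁ : ℝ} {Mstar : ℕ}
variable {𝔸 : Type} [NormedRing 𝔸] [NormedAlgebra ℂ 𝔸] [CompleteSpace 𝔸] (P : RegExtraY d ℓ hd hL b₀ b₁ Mstar 𝔸) (G : Subgroup 𝔸ˣ)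
  {J : Type} (f : J → MemberY d ℓ hd hL b₀ b₁ Mstar) {ι : Type} [Fintype ι] (b : Module.Basis ι ℝ 𝔸)
  (ιB : ∀ j : J, BlkY (f j).toKIdx → IBondY (f j).toKIdx) (C38 : ∀ j : J, ℝ → CfgY 𝔸 (f j).toKIdx → AfldY 𝔸 (f j).toKIdx → Prop)
  (ops : ∀ x : MemberY d ℓ hd hL b₀ b₁ Mstar, OperatorLayerY d ℓ hd hL b₀ b₁ Mstar 𝔸 G x)

/-- ★★★ **THE [B9] CARRIER BUNDLE OVER THE CODED CARRIER** on the subfamily `f` with block sections `ιB` and fibre basis `b`: index `J`; backgrounds = dag-n06-c's coded carriers at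
the extended class `C37GY … (cqY d)` over the class parameter `P`; `G′ ∕ G` read in U-LETTERS (`KSCU` at `parSymY`, `KACU` at `GAY … parSymY parBY (GpY … parSymY)`, `parBY`); the record's (3.48) C⁻¹ kernel `CinvY P` (the class-parametric twin `B9SectBKerFrameCodedYR.CinvY`, at `parSymY`) and every
other carrier of `ops (f j)` RE-TYPED over `bg9YC 𝔸 G P (f j)` (MODULE 3-R, fieldwise, as `carriersYR`) and READ ALONG THE DECODING; the analyticity slot `IsAnKY … b`;
geometric fields = the record's along `f`.
[cite: Balaban1985BackgroundPropagators, Thm 3.4 p.400 («extend … as analytic functions of A»), (3.37)–(3.38) p.396, Thms 3.1–3.15 pp.397–432 (the carriers)] -/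
def carriersYU : PrintedCarriers9X where
  I9 := J
  d9 := d + 1
  c35 := c35Y
  geo9 := fun j => geo9Y (f j)
  bg9 := fun j => (codingYU P G f ιB C38 j).bg
  InCube := fun j => InCubeY (f j)
  Gp := fun j => KSCU P G (f j) (parSymY (f j).toKIdx) (C37GY G (f j) (ιB j) (cqY d)) (C38 j)
  GA := fun j => KACU P G (f j) (GAY (f j).toKIdx (parSymY (f j).toKIdx) (parBY (f j).toKIdx) (GpY (f j).toKIdx (parSymY (f j).toKIdx))) (parBY (f j).toKIdx)
    (C37GY G (f j) (ιB j) (cqY d)) (C38 j)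
  Cinv := fun j => pullS (codingYU P G f ιB C38 j) (CinvY P f G (fun j => parSymY (f j).toKIdx) j)
  IsAnalyticExt := fun j => IsAnKY P G (f j) (parSymY (f j).toKIdx) b (C37GY G (f j) (ιB j) (cqY d)) (C38 j)
  E37 := fun j => pullRW (codingYU P G f ιB C38 j) (rwExpansionR (regC335 𝔸 G P) (regC336 𝔸 G P) (ops (f j)).E37)
  EK39 := fun j => pullRWK (codingYU P G f ιB C38 j) (rwKernelExpansionR (regC335 𝔸 G P) (regC336 𝔸 G P) (ops (f j)).EK39)
  E310 := fun j => pullRW (codingYU P G f ιB C38 j) (rwExpansionR (regC335 𝔸 G P) (regC336 𝔸 G P) (ops (f j)).E310)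
  PosDef := fun j n => pullC (codingYU P G f ιB C38 j) ((ops (f j)).PosDef n)
  GD := fun j => pullK (codingYU P G f ιB C38 j) (kernelFamilyR (regC335 𝔸 G P) (regC336 𝔸 G P) (ops (f j)).GD)
  G₁ := fun j => pullK (codingYU P G f ιB C38 j) (kernelFamilyR (regC335 𝔸 G P) (regC336 𝔸 G P) (ops (f j)).G₁)
  H := fun j => pullH (codingYU P G f ιB C38 j) (hKernelR (regC335 𝔸 G P) (regC336 𝔸 G P) (ops (f j)).H)
  H₁ := fun j => pullH (codingYU P G f ιB C38 j) (hKernelR (regC335 𝔸 G P) (regC336 𝔸 G P) (ops (f j)).H₁)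
  HasRWExp := fun j => pullPK (codingYU P G f ιB C38 j) (fun K => (ops (f j)).HasRWExp (kernelFamilyRY K))
  HasRWExpH := fun j => pullPH (codingYU P G f ιB C38 j) (fun K => (ops (f j)).HasRWExpH (hKernelRY K))
  PosDefK := fun j => pullPK₀ (codingYU P G f ιB C38 j) (fun K => (ops (f j)).PosDefK (kernelFamilyRY K))
  GG := fun j => pullK (codingYU P G f ιB C38 j) (kernelFamilyR (regC335 𝔸 G P) (regC336 𝔸 G P) (ops (f j)).GG)
  Kdiff := fun j => pullK (codingYU P G f ιB C38 j) (kernelFamilyR (regC335 𝔸 G P) (regC336 𝔸 G P) (ops (f j)).Kdiff)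
  dOmega := fun j => dOmegaY (f j)
  Ck := fun j => pullS (codingYU P G f ιB C38 j) (siteKernelR (regC335 𝔸 G P) (regC336 𝔸 G P) (ops (f j)).Ck)
  inΛ := fun j => inΛY (f j)
  unitDist := fun j => unitDistY (f j)
  GivenBy3185 := fun j => pullC (codingYU P G f ιB C38 j) (ops (f j)).GivenBy3185
  HasRWExpC := fun j => pullC (codingYU P G f ιB C38 j) (ops (f j)).HasRWExpC
  P349 := fun j => pullF (codingYU P G f ιB C38 j) (fineKernelR (regC335 𝔸 G P) (regC336 𝔸 G P) (ops (f j)).P349)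
  QGQinv := fun j => pullS (codingYU P G f ιB C38 j) (siteKernelR (regC335 𝔸 G P) (regC336 𝔸 G P) (ops (f j)).QGQinv)
  QG1Qinv := fun j => pullS (codingYU P G f ιB C38 j) (siteKernelR (regC335 𝔸 G P) (regC336 𝔸 G P) (ops (f j)).QG1Qinv)
  OmK := fun j => OmKY (f j)

/-! ### §2a. The projections (`rfl`) -/

/-- the index of the bundle is `J`. [cite: Balaban1985BackgroundPropagators, p.399 (the family), bookkeeping] -/
theorem carriersYU_I9 : (carriersYU P G f b ιB C38 ops).I9 = J := rfl
/-- the lattice dimension of the bundle is `d + 1`. [cite: Balaban1985BackgroundPropagators, Sect. A p.396, bookkeeping] -/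
theorem carriersYU_d9 : (carriersYU P G f b ιB C38 ops).d9 = d + 1 := rfl
/-- the (3.35) threshold of the bundle is `c35Y`. [cite: Balaban1985BackgroundPropagators, p.396 («≧ 10»), bookkeeping] -/
theorem carriersYU_c35 : (carriersYU P G f b ιB C38 ops).c35 = c35Y := rfl
/-- … `= 10`. [cite: Balaban1985BackgroundPropagators, p.396 («≧ 10»), bookkeeping] -/
theorem carriersYU_c35_eq : (carriersYU P G f b ιB C38 ops).c35 = 10 := rfl
/-- the geometry at `j` is the member `f j`'s. [cite: Balaban1985BackgroundPropagators, Sect. A pp.396–397, bookkeeping] -/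
theorem carriersYU_geo9 (j : J) : (carriersYU P G f b ιB C38 ops).geo9 j = geo9Y (f j) := rfl
/-- **the backgrounds at `j` are the coded carrier of `f j`** at the extended class. [cite: Balaban1985BackgroundPropagators, (3.37)–(3.38) p.396] -/
theorem carriersYU_bg9 (j : J) : (carriersYU P G f b ιB C38 ops).bg9 j = (codingYU P G f ιB C38 j).bg := rfl
/-- … spelled through `codingYx`. [cite: Balaban1985BackgroundPropagators, (3.37)–(3.38) p.396, bookkeeping] -/
theorem carriersYU_bg9_eq (j : J) : (carriersYU P G f b ιB C38 ops).bg9 j = (codingYx P G (f j) (C37GY G (f j) (ιB j) (cqY d)) (C38 j)).bg := rfl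
/-- Cor. 3.6's cube predicate at `j` is `InCubeY (f j)`. [cite: Balaban1985BackgroundPropagators, Cor. 3.6 p.408, bookkeeping] -/
theorem carriersYU_InCube (j : J) : (carriersYU P G f b ιB C38 ops).InCube j = InCubeY (f j) := rfl
/-- **`G′` at `j` is the U-letter site reading `KSCU` at `parSymY`.** [cite: Balaban1985BackgroundPropagators, Thm 3.4 p.400, (3.42)–(3.47) pp.397–398] -/
theorem carriersYU_Gp (j : J) :
    (carriersYU P G f b ιB C38 ops).Gp j = KSCU P G (f j) (parSymY (f j).toKIdx) (C37GY G (f j) (ιB j) (cqY d)) (C38 j) := rfl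
/-- **`G` at `j` is the U-letter bond reading `KACU`** at `GAY … parSymY parBY (GpY … parSymY)`, `parBY`. [cite: Balaban1985BackgroundPropagators, Thm 3.4 p.400, (3.84)–(3.86) p.407] -/
theorem carriersYU_GA (j : J) :
    (carriersYU P G f b ιB C38 ops).GA j = KACU P G (f j) (GAY (f j).toKIdx (parSymY (f j).toKIdx) (parBY (f j).toKIdx) (GpY (f j).toKIdx (parSymY (f j).toKIdx)))
      (parBY (f j).toKIdx) (C37GY G (f j) (ιB j) (cqY d)) (C38 j) := rfl
/-- `C⁻¹` at `j` is the class-parametric kernel `CinvY P` (`B9SectBKerFrameCodedYR`, bundle `B9SectBCodedChainR4`) at `parSymY`, read along the decoding —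
BY NAME, as dag-n06-d's (α3) consumes it (`rfl`). [cite: Balaban1985BackgroundPropagators, Cor. 3.6 p.408, bookkeeping] -/
theorem carriersYU_Cinv (j : J) :
    (carriersYU P G f b ιB C38 ops).Cinv j = pullS (codingYU P G f ιB C38 j) (CinvY P f G (fun j => parSymY (f j).toKIdx) j) := rfl

/-- FACE: `C⁻¹` at `j` UNFOLDED — the record's (3.48) kernel of the letter `C = CY parSymY (GpY parSymY)` at the carrier blocks (the `siteKernelOfOp` reading of
`Node00.OpsYOfLetters`, = the body of `CinvY P` at `par := parSymY`) read along the decoding (`rfl`). [cite: Balaban1985BackgroundPropagators, Thm 3.2 (3.48) p.398,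
Cor. 3.6 p.408, bookkeeping] -/
theorem carriersYU_Cinv_eq_siteKernelOfOp (j : J) :
    (carriersYU P G f b ιB C38 ops).Cinv j = pullS (codingYU P G f ιB C38 j)
      (siteKernelOfOp (f j).toKIdx (bg9YC 𝔸 G P (f j)) (fun U => U)
        (CY (f j).toKIdx (parSymY (f j).toKIdx) (GpY (f j).toKIdx (parSymY (f j).toKIdx)))
        (β (f j).toKIdx.hN (f j).toKIdx.D (f j).toKIdx.hk) (β (f j).toKIdx.hN (f j).toKIdx.D (f j).toKIdx.hk)) := rfl
/-- **the analyticity slot at `j` is `IsAnKY … b`.** [cite: Balaban1985BackgroundPropagators, Thm 3.4 p.400 («extend … as analytic functions of A»)] -/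
theorem carriersYU_IsAnalyticExt (j : J) :
    (carriersYU P G f b ιB C38 ops).IsAnalyticExt j = IsAnKY P G (f j) (parSymY (f j).toKIdx) b (C37GY G (f j) (ιB j) (cqY d)) (C38 j) := rfl
/-- Thm 3.7's expansion at `j` is the record's read along the decoding. [cite: Balaban1985BackgroundPropagators, Thm 3.7 (3.87) p.409, bookkeeping] -/
theorem carriersYU_E37 (j : J) : (carriersYU P G f b ιB C38 ops).E37 j = pullRW (codingYU P G f ιB C38 j) (rwExpansionR (regC335 𝔸 G P) (regC336 𝔸 G P) (ops (f j)).E37) := rfl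
/-- Thm 3.9's kernel expansion at `j` is the record's read along the decoding. [cite: Balaban1985BackgroundPropagators, Thm 3.9 (3.99) p.412, bookkeeping] -/
theorem carriersYU_EK39 (j : J) : (carriersYU P G f b ιB C38 ops).EK39 j = pullRWK (codingYU P G f ιB C38 j) (rwKernelExpansionR (regC335 𝔸 G P) (regC336 𝔸 G P) (ops (f j)).EK39) := rfl
/-- Thm 3.10's expansion at `j` is the record's read along the decoding. [cite: Balaban1985BackgroundPropagators, Thm 3.10 (3.107) p.415, bookkeeping] -/
theorem carriersYU_E310 (j : J) : (carriersYU P G f b ιB C38 ops).E310 j = pullRW (codingYU P G f ιB C38 j) (rwExpansionR (regC335 𝔸 G P) (regC336 𝔸 G P) (ops (f j)).E310) := rfl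
/-- Thm 3.11's positivity slots at `j` are the record's read along the decoding. [cite: Balaban1985BackgroundPropagators, Thm 3.11 p.416, bookkeeping] -/
theorem carriersYU_PosDef (j : J) (n : Fin 5) : (carriersYU P G f b ιB C38 ops).PosDef j n = pullC (codingYU P G f ιB C38 j) ((ops (f j)).PosDef n) := rfl
/-- `G(Ω)` (Dirichlet) at `j` is the record's read along the decoding. [cite: Balaban1985BackgroundPropagators, Thm 3.12 p.422, bookkeeping] -/
theorem carriersYU_GD (j : J) : (carriersYU P G f b ιB C38 ops).GD j = pullK (codingYU P G f ιB C38 j) (kernelFamilyR (regC335 𝔸 G P) (regC336 𝔸 G P) (ops (f j)).GD) := rfl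
/-- `G₁` at `j` is the record's read along the decoding. [cite: Balaban1985BackgroundPropagators, (3.134) p.422, bookkeeping] -/
theorem carriersYU_G₁ (j : J) : (carriersYU P G f b ιB C38 ops).G₁ j = pullK (codingYU P G f ιB C38 j) (kernelFamilyR (regC335 𝔸 G P) (regC336 𝔸 G P) (ops (f j)).G₁) := rfl
/-- `H` at `j` is the record's read along the decoding. [cite: Balaban1985BackgroundPropagators, (3.133) p.422, bookkeeping] -/
theorem carriersYU_H (j : J) : (carriersYU P G f b ιB C38 ops).H j = pullH (codingYU P G f ιB C38 j) (hKernelR (regC335 𝔸 G P) (regC336 𝔸 G P) (ops (f j)).H) := rfl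
/-- `H₁` at `j` is the record's read along the decoding. [cite: Balaban1985BackgroundPropagators, (3.133) p.422, bookkeeping] -/
theorem carriersYU_H₁ (j : J) : (carriersYU P G f b ιB C38 ops).H₁ j = pullH (codingYU P G f ιB C38 j) (hKernelR (regC335 𝔸 G P) (regC336 𝔸 G P) (ops (f j)).H₁) := rfl
/-- «has the random-walk expansion» at `j` is the record's read along the decoding. [cite: Balaban1985BackgroundPropagators, Thm 3.13 p.426, bookkeeping] -/
theorem carriersYU_HasRWExp (j : J) : (carriersYU P G f b ιB C38 ops).HasRWExp j = pullPK (codingYU P G f ιB C38 j) (fun K => (ops (f j)).HasRWExp (kernelFamilyRY K)) := rfl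
/-- «`H` has the random-walk expansion» at `j` is the record's read along the decoding. [cite: Balaban1985BackgroundPropagators, Thm 3.13 p.426, bookkeeping] -/
theorem carriersYU_HasRWExpH (j : J) : (carriersYU P G f b ιB C38 ops).HasRWExpH j = pullPH (codingYU P G f ιB C38 j) (fun K => (ops (f j)).HasRWExpH (hKernelRY K)) := rfl
/-- «is positive definite» (on families) at `j` is the record's read along the decoding. [cite: Balaban1985BackgroundPropagators, Thm 3.12 p.422, bookkeeping] -/
theorem carriersYU_PosDefK (j : J) : (carriersYU P G f b ιB C38 ops).PosDefK j = pullPK₀ (codingYU P G f ιB C38 j) (fun K => (ops (f j)).PosDefK (kernelFamilyRY K)) := rfl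
/-- `G(Ω)` (Thm 3.13's family) at `j` is the record's read along the decoding. [cite: Balaban1985BackgroundPropagators, Thm 3.13 p.426, bookkeeping] -/
theorem carriersYU_GG (j : J) : (carriersYU P G f b ιB C38 ops).GG j = pullK (codingYU P G f ιB C38 j) (kernelFamilyR (regC335 𝔸 G P) (regC336 𝔸 G P) (ops (f j)).GG) := rfl
/-- Thm 3.14's difference family at `j` is the record's read along the decoding. [cite: Balaban1985BackgroundPropagators, Thm 3.14 p.427, bookkeeping] -/
theorem carriersYU_Kdiff (j : J) : (carriersYU P G f b ιB C38 ops).Kdiff j = pullK (codingYU P G f ιB C38 j) (kernelFamilyR (regC335 𝔸 G P) (regC336 𝔸 G P) (ops (f j)).Kdiff) := rfl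
/-- (3.154) at `j` is `dOmegaY (f j)`. [cite: Balaban1985BackgroundPropagators, (3.154) p.427, bookkeeping] -/
theorem carriersYU_dOmega (j : J) : (carriersYU P G f b ιB C38 ops).dOmega j = dOmegaY (f j) := rfl
/-- `C^{(k)}(Λ;U)` at `j` is the record's read along the decoding. [cite: Balaban1985BackgroundPropagators, (3.157) p.428, bookkeeping] -/
theorem carriersYU_Ck (j : J) : (carriersYU P G f b ιB C38 ops).Ck j = pullS (codingYU P G f ιB C38 j) (siteKernelR (regC335 𝔸 G P) (regC336 𝔸 G P) (ops (f j)).Ck) := rfl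
/-- `Λ` at `j` is `inΛY (f j)`. [cite: Balaban1985BackgroundPropagators, p.427 («Λ … is a union of big blocks»), bookkeeping] -/
theorem carriersYU_inΛ (j : J) : (carriersYU P G f b ιB C38 ops).inΛ j = inΛY (f j) := rfl
/-- the unit distance at `j` is `unitDistY (f j)`. [cite: Balaban1985BackgroundPropagators, (3.185) p.432, bookkeeping] -/
theorem carriersYU_unitDist (j : J) : (carriersYU P G f b ιB C38 ops).unitDist j = unitDistY (f j) := rfl
/-- (3.185) at `j` is the record's read along the decoding. [cite: Balaban1985BackgroundPropagators, (3.185) p.432, bookkeeping] -/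
theorem carriersYU_GivenBy3185 (j : J) : (carriersYU P G f b ιB C38 ops).GivenBy3185 j = pullC (codingYU P G f ιB C38 j) (ops (f j)).GivenBy3185 := rfl
/-- (3.186)'s expansion predicate at `j` is the record's read along the decoding. [cite: Balaban1985BackgroundPropagators, (3.186) p.432, bookkeeping] -/
theorem carriersYU_HasRWExpC (j : J) : (carriersYU P G f b ιB C38 ops).HasRWExpC j = pullC (codingYU P G f ιB C38 j) (ops (f j)).HasRWExpC := rfl
/-- the (3.49) fine kernel at `j` is the record's read along the decoding. [cite: Balaban1985BackgroundPropagators, (3.49) p.399, bookkeeping] -/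
theorem carriersYU_P349 (j : J) : (carriersYU P G f b ιB C38 ops).P349 j = pullF (codingYU P G f ιB C38 j) (fineKernelR (regC335 𝔸 G P) (regC336 𝔸 G P) (ops (f j)).P349) := rfl
/-- `QGQ*⁻¹` (3.132) at `j` is the record's read along the decoding. [cite: Balaban1985BackgroundPropagators, (3.132) p.422, bookkeeping] -/
theorem carriersYU_QGQinv (j : J) : (carriersYU P G f b ιB C38 ops).QGQinv j = pullS (codingYU P G f ιB C38 j) (siteKernelR (regC335 𝔸 G P) (regC336 𝔸 G P) (ops (f j)).QGQinv) := rfl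
/-- `QG₁Q*⁻¹` (3.132) at `j` is the record's read along the decoding. [cite: Balaban1985BackgroundPropagators, (3.132) p.422, bookkeeping] -/
theorem carriersYU_QG1Qinv (j : J) : (carriersYU P G f b ιB C38 ops).QG1Qinv j = pullS (codingYU P G f ιB C38 j) (siteKernelR (regC335 𝔸 G P) (regC336 𝔸 G P) (ops (f j)).QG1Qinv) := rfl
/-- `Ω_k` at `j` is `OmKY (f j)`. [cite: Balaban1985BackgroundPropagators, Thm 3.14 p.427, bookkeeping] -/
theorem carriersYU_OmK (j : J) : (carriersYU P G f b ιB C38 ops).OmK j = OmKY (f j) := rfl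

/-- the index of the bundle is inhabited when the subfamily's index is. [cite: Balaban1985BackgroundPropagators, p.399 (the family), bookkeeping] -/
theorem carriersYU_nonempty_I9 [h : Nonempty J] : Nonempty (carriersYU P G f b ιB C38 ops).I9 := h

/-! ### §2b. At a base code the pulled-back carriers read the record's at `U` (`rfl`) -/

/-- `G(Ω)`'s entries at a base code are the record's at its configuration. [cite: Balaban1985BackgroundPropagators, Thm 3.12 p.422, bookkeeping] -/
theorem carriersYU_GD_e_base (j : J) (n : Fin 4) (U : CfgY 𝔸 (f j).toKIdx) :
    ((carriersYU P G f b ιB C38 ops).GD j).e n (.base U) = (ops (f j)).GD.e n U := rfl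
/-- `G₁`'s entries at a base code are the record's. [cite: Balaban1985BackgroundPropagators, (3.134) p.422, bookkeeping] -/
theorem carriersYU_G₁_e_base (j : J) (n : Fin 4) (U : CfgY 𝔸 (f j).toKIdx) :
    ((carriersYU P G f b ιB C38 ops).G₁ j).e n (.base U) = (ops (f j)).G₁.e n U := rfl
/-- `GG`'s entries at a base code are the record's. [cite: Balaban1985BackgroundPropagators, Thm 3.13 p.426, bookkeeping] -/
theorem carriersYU_GG_e_base (j : J) (n : Fin 4) (U : CfgY 𝔸 (f j).toKIdx) :
    ((carriersYU P G f b ιB C38 ops).GG j).e n (.base U) = (ops (f j)).GG.e n U := rfl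
/-- `Kdiff`'s entries at a base code are the record's. [cite: Balaban1985BackgroundPropagators, Thm 3.14 p.427, bookkeeping] -/
theorem carriersYU_Kdiff_e_base (j : J) (n : Fin 4) (U : CfgY 𝔸 (f j).toKIdx) :
    ((carriersYU P G f b ιB C38 ops).Kdiff j).e n (.base U) = (ops (f j)).Kdiff.e n U := rfl
/-- `H`'s kernel at a base code is the record's. [cite: Balaban1985BackgroundPropagators, (3.133) p.422, bookkeeping] -/
theorem carriersYU_H_h_base (j : J) (U : CfgY 𝔸 (f j).toKIdx) : ((carriersYU P G f b ιB C38 ops).H j).h (.base U) = (ops (f j)).H.h U := rfl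
/-- `H₁`'s kernel at a base code is the record's. [cite: Balaban1985BackgroundPropagators, (3.133) p.422, bookkeeping] -/
theorem carriersYU_H₁_h_base (j : J) (U : CfgY 𝔸 (f j).toKIdx) : ((carriersYU P G f b ιB C38 ops).H₁ j).h (.base U) = (ops (f j)).H₁.h U := rfl
/-- `C^{(k)}(Λ;U)`'s kernel at a base code is the record's. [cite: Balaban1985BackgroundPropagators, (3.157) p.428, bookkeeping] -/
theorem carriersYU_Ck_ker_base (j : J) (U : CfgY 𝔸 (f j).toKIdx) : ((carriersYU P G f b ιB C38 ops).Ck j).ker (.base U) = (ops (f j)).Ck.ker U := rfl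
/-- `QGQ*⁻¹`'s kernel at a base code is the record's. [cite: Balaban1985BackgroundPropagators, (3.132) p.422, bookkeeping] -/
theorem carriersYU_QGQinv_ker_base (j : J) (U : CfgY 𝔸 (f j).toKIdx) : ((carriersYU P G f b ιB C38 ops).QGQinv j).ker (.base U) = (ops (f j)).QGQinv.ker U := rfl
/-- `QG₁Q*⁻¹`'s kernel at a base code is the record's. [cite: Balaban1985BackgroundPropagators, (3.132) p.422, bookkeeping] -/
theorem carriersYU_QG1Qinv_ker_base (j : J) (U : CfgY 𝔸 (f j).toKIdx) : ((carriersYU P G f b ιB C38 ops).QG1Qinv j).ker (.base U) = (ops (f j)).QG1Qinv.ker U := rfl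
/-- the (3.49) fine kernel at a base code is the record's. [cite: Balaban1985BackgroundPropagators, (3.49) p.399, bookkeeping] -/
theorem carriersYU_P349_ker_base (j : J) (n : Fin 4) (U : CfgY 𝔸 (f j).toKIdx) :
    ((carriersYU P G f b ιB C38 ops).P349 j).ker n (.base U) = (ops (f j)).P349.ker n U := rfl
/-- Thm 3.11's positivity slot at a base code is the record's. [cite: Balaban1985BackgroundPropagators, Thm 3.11 p.416, bookkeeping] -/
theorem carriersYU_PosDef_base (j : J) (n : Fin 5) (U : CfgY 𝔸 (f j).toKIdx) : (carriersYU P G f b ιB C38 ops).PosDef j n (.base U) = (ops (f j)).PosDef n U := rfl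
/-- (3.185) at a base code is the record's. [cite: Balaban1985BackgroundPropagators, (3.185) p.432, bookkeeping] -/
theorem carriersYU_GivenBy3185_base (j : J) (U : CfgY 𝔸 (f j).toKIdx) : (carriersYU P G f b ιB C38 ops).GivenBy3185 j (.base U) = (ops (f j)).GivenBy3185 U := rfl
/-- (3.186)'s expansion predicate at a base code is the record's. [cite: Balaban1985BackgroundPropagators, (3.186) p.432, bookkeeping] -/
theorem carriersYU_HasRWExpC_base (j : J) (U : CfgY 𝔸 (f j).toKIdx) : (carriersYU P G f b ιB C38 ops).HasRWExpC j (.base U) = (ops (f j)).HasRWExpC U := rfl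

/-! ### §2c. The classes of the coded carrier at a base code, unfolded (`Iff.rfl`): what a leaf over the bundle reads as (3.35)–(3.38) -/

/-- the configurations of the coded carrier at `j` are the codes over the member's configurations and the fields `A′`. [cite: Balaban1985BackgroundPropagators, (3.37) p.396 («U′ = exp iηA′»), bookkeeping] -/
theorem carriersYU_bg9_Cfg (j : J) : ((carriersYU P G f b ιB C38 ops).bg9 j).Cfg = CCfg (CfgY 𝔸 (f j).toKIdx) (AfldY 𝔸 (f j).toKIdx) := rfl
/-- **(3.35) of the coded carrier at a base code READS the parameter's `(«U is G-valued» ∧ P.P₁) ∧ P.P₂` at the member `f j`.** [cite: Balaban1985BackgroundPropagators, (3.35) p.396 («U with values in G … O(1)»)] -/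
theorem carriersYU_bg9_Reg335_base_iff (j : J) (c α₀ : ℝ) (U : CfgY 𝔸 (f j).toKIdx) :
    ((carriersYU P G f b ιB C38 ops).bg9 j).Reg335 c α₀ (.base U) ↔ (GVal G (f j).toKIdx U ∧ P.P₁ (f j) c α₀ U) ∧ P.P₂ (f j) c α₀ U := Iff.rfl
/-- … i.e. the class-parametric member carrier's (3.35) at `U`. [cite: Balaban1985BackgroundPropagators, (3.35) p.396, bookkeeping] -/
theorem carriersYU_bg9_Reg335_base_iff_bg9YC (j : J) (c α₀ : ℝ) (U : CfgY 𝔸 (f j).toKIdx) :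
    ((carriersYU P G f b ιB C38 ops).bg9 j).Reg335 c α₀ (.base U) ↔ (bg9YC 𝔸 G P (f j)).Reg335 c α₀ U := Iff.rfl
/-- **(3.36) of the coded carrier at a base code READS the parameter's `(«U is G-valued» ∧ P.Q₁) ∧ P.Q₂` at `f j`.** [cite: Balaban1985BackgroundPropagators, (3.36) p.396] -/
theorem carriersYU_bg9_Reg336_base_iff (j : J) (c α₀ : ℝ) (U : CfgY 𝔸 (f j).toKIdx) :
    ((carriersYU P G f b ιB C38 ops).bg9 j).Reg336 c α₀ (.base U) ↔ (GVal G (f j).toKIdx U ∧ P.Q₁ (f j) c α₀ U) ∧ P.Q₂ (f j) c α₀ U := Iff.rfl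
/-- no multiplier code `U′` is (3.35)-regular (the classes (3.35)–(3.36) live on the base codes). [cite: Balaban1985BackgroundPropagators, (3.35), (3.37) p.396, bookkeeping] -/
theorem carriersYU_bg9_not_Reg335_mult (j : J) (c α₀ : ℝ) (a : AfldY 𝔸 (f j).toKIdx) : ¬ ((carriersYU P G f b ιB C38 ops).bg9 j).Reg335 c α₀ (.mult a) := fun h => h
/-- no product code `U′U` is (3.35)-regular. [cite: Balaban1985BackgroundPropagators, (3.35), (3.37) p.396, bookkeeping] -/
theorem carriersYU_bg9_not_Reg335_prod (j : J) (c α₀ : ℝ) (U : CfgY 𝔸 (f j).toKIdx) (a : AfldY 𝔸 (f j).toKIdx) :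
    ¬ ((carriersYU P G f b ιB C38 ops).bg9 j).Reg335 c α₀ (.prod U a) := fun h => h
/-- **(3.37) of the coded carrier between a base code and a multiplier code READS the extended class `C37GY … (cqY d)`.** [cite: Balaban1985BackgroundPropagators, (3.37) p.396] -/
theorem carriersYU_bg9_Cplx337_base_mult_iff (j : J) (α : ℝ) (U : CfgY 𝔸 (f j).toKIdx) (a : AfldY 𝔸 (f j).toKIdx) :
    ((carriersYU P G f b ιB C38 ops).bg9 j).Cplx337 α (.base U) (.mult a) ↔ C37GY G (f j) (ιB j) (cqY d) α U a := Iff.rfl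
/-- **(3.38) of the coded carrier between a base code and a multiplier code READS the parameter class `C38 j`.** [cite: Balaban1985BackgroundPropagators, (3.38) p.396] -/
theorem carriersYU_bg9_Cplx338_base_mult_iff (j : J) (α : ℝ) (U : CfgY 𝔸 (f j).toKIdx) (a : AfldY 𝔸 (f j).toKIdx) :
    ((carriersYU P G f b ιB C38 ops).bg9 j).Cplx338 α (.base U) (.mult a) ↔ C38 j α U a := Iff.rfl
/-- the carrier's product of a multiplier code with a base code is the product code (decoding to `U′U`). [cite: Balaban1985BackgroundPropagators, (3.37) p.396 («U′U»), bookkeeping] -/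
theorem carriersYU_bg9_mul_mult_base (j : J) (U : CfgY 𝔸 (f j).toKIdx) (a : AfldY 𝔸 (f j).toKIdx) :
    ((carriersYU P G f b ιB C38 ops).bg9 j).mul (.mult a) (.base U) = .prod U a := rfl

end Bundle

/-! ## §3. At the record: `M_N(ℂ)`, `SU(N)`, the Stage-3 dictionary — `Y9OfRecordU` -/

section Record

variable (N : ℕ)

/-- ★★ **THE [B9] CARRIER BUNDLE OF RECORD OVER THE CODED CARRIER** at `(θ, Mstar, ops)` on the subfamily `f` with sections `ιB`, fibre basis `b` and (3.38) classes `C38`: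
`carriersYU` at `M_N(ℂ)`, `SU(N)` and the record's Stage-3 geometry — the coded-carrier sibling of `Y9OfRecordP N θ Mstar ops`.
[cite: Balaban1985BackgroundPropagators, Thm 3.4 p.400, (3.37)–(3.38) p.396, Thms 3.1–3.15 pp.397–432] -/
def Y9OfRecordU (θ : Stage3Params) (Mstar : ℕ) (P : RegExtraY θ.d₆ θ.ℓ₆ θ.hd' θ.hL' θ.b₀ θ.b₁ Mstar (Matrix (Fin N) (Fin N) ℂ)) (ops : OpsY N θ Mstar) {J : Type} (f : J → MemberY θ.d₆ θ.ℓ₆ θ.hd' θ.hL' θ.b₀ θ.b₁ Mstar)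
    {ι : Type} [Fintype ι] (b : Module.Basis ι ℝ (Matrix (Fin N) (Fin N) ℂ))
    (ιB : ∀ j : J, BlkY (f j).toKIdx → IBondY (f j).toKIdx)
    (C38 : ∀ j : J, ℝ → CfgY (Matrix (Fin N) (Fin N) ℂ) (f j).toKIdx → AfldY (Matrix (Fin N) (Fin N) ℂ) (f j).toKIdx → Prop) : PrintedCarriers9X :=
  carriersYU P (specialUnitaryUnits (Fin N)) f b ιB C38 ops

variable {N}
variable (θ : Stage3Params) (Mstar : ℕ) (P : RegExtraY θ.d₆ θ.ℓ₆ θ.hd' θ.hL' θ.b₀ θ.b₁ Mstar (Matrix (Fin N) (Fin N) ℂ)) (ops : OpsY N θ Mstar) {J : Type} (f : J → MemberY θ.d₆ θ.ℓ₆ θ.hd' θ.hL' θ.b₀ θ.b₁ Mstar)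
  {ι : Type} [Fintype ι] (b : Module.Basis ι ℝ (Matrix (Fin N) (Fin N) ℂ))
  (ιB : ∀ j : J, BlkY (f j).toKIdx → IBondY (f j).toKIdx)
  (C38 : ∀ j : J, ℝ → CfgY (Matrix (Fin N) (Fin N) ℂ) (f j).toKIdx → AfldY (Matrix (Fin N) (Fin N) ℂ) (f j).toKIdx → Prop)

/-- `Y9OfRecordU` unfolded (`rfl`). [cite: Balaban1985BackgroundPropagators, Thm 3.4 p.400, bookkeeping] -/
theorem Y9OfRecordU_eq : Y9OfRecordU N θ Mstar P ops f b ιB C38 = carriersYU P (specialUnitaryUnits (Fin N)) f b ιB C38 ops := rfl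
/-- the index of the bundle of record over the coded carrier is `J`. [cite: Balaban1985BackgroundPropagators, p.399, bookkeeping] -/
theorem Y9OfRecordU_I9 : (Y9OfRecordU N θ Mstar P ops f b ιB C38).I9 = J := rfl
/-- … inhabited when `J` is. [cite: Balaban1985BackgroundPropagators, p.399, bookkeeping] -/
theorem Y9OfRecordU_nonempty_I9 [h : Nonempty J] : Nonempty (Y9OfRecordU N θ Mstar P ops f b ιB C38).I9 := h
/-- **the backgrounds of record over the coded carrier at `j`** = the coding of `bg9Y (M_N(ℂ)) SU(N) (f j)` at the extended class. [cite: Balaban1985BackgroundPropagators, (3.37)–(3.38) p.396] -/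
theorem Y9OfRecordU_bg9 (j : J) : (Y9OfRecordU N θ Mstar P ops f b ιB C38).bg9 j = (codingYU P (specialUnitaryUnits (Fin N)) f ιB C38 j).bg := rfl
/-- **`G′` of record over the coded carrier at `j`** = `KSCU` at `SU(N)`, `parSymY`. [cite: Balaban1985BackgroundPropagators, Thm 3.4 p.400] -/
theorem Y9OfRecordU_Gp (j : J) : (Y9OfRecordU N θ Mstar P ops f b ιB C38).Gp j =
    KSCU P (specialUnitaryUnits (Fin N)) (f j) (parSymY (f j).toKIdx) (C37GY (specialUnitaryUnits (Fin N)) (f j) (ιB j) (cqY θ.d₆)) (C38 j) := rfl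
/-- **`G` of record over the coded carrier at `j`** = `KACU` at `SU(N)`, `GAY … parSymY parBY (GpY … parSymY)`, `parBY`. [cite: Balaban1985BackgroundPropagators, Thm 3.4 p.400] -/
theorem Y9OfRecordU_GA (j : J) : (Y9OfRecordU N θ Mstar P ops f b ιB C38).GA j =
    KACU P (specialUnitaryUnits (Fin N)) (f j) (GAY (f j).toKIdx (parSymY (f j).toKIdx) (parBY (f j).toKIdx) (GpY (f j).toKIdx (parSymY (f j).toKIdx)))
      (parBY (f j).toKIdx) (C37GY (specialUnitaryUnits (Fin N)) (f j) (ιB j) (cqY θ.d₆)) (C38 j) := rfl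
/-- `C⁻¹` of record over the coded carrier at `j` = `CinvY P` read along the decoding (by name, `rfl`). [cite: Balaban1985BackgroundPropagators, Cor. 3.6 p.408,
bookkeeping] -/
theorem Y9OfRecordU_Cinv (j : J) : (Y9OfRecordU N θ Mstar P ops f b ιB C38).Cinv j =
    pullS (codingYU P (specialUnitaryUnits (Fin N)) f ιB C38 j) (CinvY P f (specialUnitaryUnits (Fin N)) (fun j => parSymY (f j).toKIdx) j) := rfl
/-- **the analyticity slot of record over the coded carrier at `j`** = `IsAnKY … b`. [cite: Balaban1985BackgroundPropagators, Thm 3.4 p.400] -/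
theorem Y9OfRecordU_IsAnalyticExt (j : J) : (Y9OfRecordU N θ Mstar P ops f b ιB C38).IsAnalyticExt j =
    IsAnKY P (specialUnitaryUnits (Fin N)) (f j) (parSymY (f j).toKIdx) b (C37GY (specialUnitaryUnits (Fin N)) (f j) (ιB j) (cqY θ.d₆)) (C38 j) := rfl
/-- `G(Ω)` of record over the coded carrier at `j` = the operator layer's read along the decoding. [cite: Balaban1985BackgroundPropagators, Thm 3.12 p.422, bookkeeping] -/
theorem Y9OfRecordU_GD (j : J) : (Y9OfRecordU N θ Mstar P ops f b ιB C38).GD j =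
    pullK (codingYU P (specialUnitaryUnits (Fin N)) f ιB C38 j) (kernelFamilyR (regC335 (Matrix (Fin N) (Fin N) ℂ) (specialUnitaryUnits (Fin N)) P) (regC336 (Matrix (Fin N) (Fin N) ℂ) (specialUnitaryUnits (Fin N)) P) (ops (f j)).GD) := rfl
/-- `C^{(k)}(Λ;U)` of record over the coded carrier at `j` = the operator layer's read along the decoding. [cite: Balaban1985BackgroundPropagators, (3.157) p.428, bookkeeping] -/
theorem Y9OfRecordU_Ck (j : J) : (Y9OfRecordU N θ Mstar P ops f b ιB C38).Ck j =
    pullS (codingYU P (specialUnitaryUnits (Fin N)) f ιB C38 j) (siteKernelR (regC335 (Matrix (Fin N) (Fin N) ℂ) (specialUnitaryUnits (Fin N)) P) (regC336 (Matrix (Fin N) (Fin N) ℂ) (specialUnitaryUnits (Fin N)) P) (ops (f j)).Ck) := rfl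
/-- (3.185) of record over the coded carrier at `j` = the operator layer's read along the decoding. [cite: Balaban1985BackgroundPropagators, (3.185) p.432, bookkeeping] -/
theorem Y9OfRecordU_GivenBy3185 (j : J) :
    (Y9OfRecordU N θ Mstar P ops f b ιB C38).GivenBy3185 j = pullC (codingYU P (specialUnitaryUnits (Fin N)) f ιB C38 j) (ops (f j)).GivenBy3185 := rfl

/-! ### §3a. The geometric fields agree with the record bundle `Y9OfRecordP` along `f` (`rfl`) -/

/-- the geometry of record over the coded carrier at `j` is the record bundle's at `f j`. [cite: Balaban1985BackgroundPropagators, Sect. A pp.396–397, bookkeeping] -/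
theorem Y9OfRecordU_geo9 (j : J) : (Y9OfRecordU N θ Mstar P ops f b ιB C38).geo9 j = (Y9OfRecordP N θ Mstar ops).geo9 (f j) := rfl
/-- the cube predicate agrees along `f`. [cite: Balaban1985BackgroundPropagators, Cor. 3.6 p.408, bookkeeping] -/
theorem Y9OfRecordU_InCube (j : J) : (Y9OfRecordU N θ Mstar P ops f b ιB C38).InCube j = (Y9OfRecordP N θ Mstar ops).InCube (f j) := rfl
/-- (3.154) agrees along `f`. [cite: Balaban1985BackgroundPropagators, (3.154) p.427, bookkeeping] -/
theorem Y9OfRecordU_dOmega (j : J) : (Y9OfRecordU N θ Mstar P ops f b ιB C38).dOmega j = (Y9OfRecordP N θ Mstar ops).dOmega (f j) := rfl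
/-- `Λ` agrees along `f`. [cite: Balaban1985BackgroundPropagators, p.427, bookkeeping] -/
theorem Y9OfRecordU_inΛ (j : J) : (Y9OfRecordU N θ Mstar P ops f b ιB C38).inΛ j = (Y9OfRecordP N θ Mstar ops).inΛ (f j) := rfl
/-- the unit distance agrees along `f`. [cite: Balaban1985BackgroundPropagators, (3.185) p.432, bookkeeping] -/
theorem Y9OfRecordU_unitDist (j : J) : (Y9OfRecordU N θ Mstar P ops f b ιB C38).unitDist j = (Y9OfRecordP N θ Mstar ops).unitDist (f j) := rfl
/-- `Ω_k` agrees along `f`. [cite: Balaban1985BackgroundPropagators, Thm 3.14 p.427, bookkeeping] -/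
theorem Y9OfRecordU_OmK (j : J) : (Y9OfRecordU N θ Mstar P ops f b ιB C38).OmK j = (Y9OfRecordP N θ Mstar ops).OmK (f j) := rfl
/-- the (3.35) threshold agrees (`= 10`). [cite: Balaban1985BackgroundPropagators, p.396 («≧ 10»), bookkeeping] -/
theorem Y9OfRecordU_c35 : (Y9OfRecordU N θ Mstar P ops f b ιB C38).c35 = (Y9OfRecordP N θ Mstar ops).c35 := rfl
/-- the lattice dimension agrees. [cite: Balaban1985BackgroundPropagators, Sect. A p.396, bookkeeping] -/
theorem Y9OfRecordU_d9 : (Y9OfRecordU N θ Mstar P ops f b ιB C38).d9 = (Y9OfRecordP N θ Mstar ops).d9 := rfl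

/-- **(3.35) of the bundle of record over the coded carrier at a base code READS the parameter's conjunction at `f j`.** [cite: Balaban1985BackgroundPropagators, (3.35) p.396] -/
theorem Y9OfRecordU_bg9_Reg335_base_iff (j : J) (c α₀ : ℝ) (U : CfgY (Matrix (Fin N) (Fin N) ℂ) (f j).toKIdx) :
    ((Y9OfRecordU N θ Mstar P ops f b ιB C38).bg9 j).Reg335 c α₀ (.base U) ↔
      (GVal (specialUnitaryUnits (Fin N)) (f j).toKIdx U ∧ P.P₁ (f j) c α₀ U) ∧ P.P₂ (f j) c α₀ U := Iff.rfl

/-! ### §3b. At the record's reading of print's class: `P := extraYPb` (`regC335 … extraYPb` is `regYPb335` up to the order of conjuncts) -/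

variable (N) in
/-- ★★ **THE [B9] CARRIER BUNDLE OF RECORD OVER THE CODED CARRIER AT THE RECORD's READING OF PRINT's CLASS (3.35)–(3.36)**: `Y9OfRecordU` at dag-n06-c's parameter
`extraYPb (M_N ℂ) SU(N)` — `P₁ ∕ Q₁` = «`0 ≤ α₀`» and print's cube condition (3.35) ∕ (3.36) at «O(1) = 10» (`c35Y`) at the member's index, `P₂ ∕ Q₂` = MODULE 2-P's field at
the second pin (constant-blind: the class-constant argument is not read); its (3.35) family `regC335 … extraYPb` IS `B9BackgroundsKLevelV1Pb.regYPb335` up to the order of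
conjuncts (`B9SectBCodedClassR.classIncl_regC335Pb_regYPb335 ∕ classIncl_regYPb335_regC335Pb`, at every pair of thresholds) — the reading «at `R₁ := regYPb335`».
NAMES the class instance; asserts nothing about it. [cite: Balaban1985BackgroundPropagators, (3.35)–(3.36) p.396 («O(1) … a number ≧ 10»), Thm 3.1 p.397 («0 < α₀ ≦ α₁»), Thm 3.4 p.400] -/
def Y9OfRecordUPb : PrintedCarriers9X :=
  Y9OfRecordU N θ Mstar (extraYPb (Matrix (Fin N) (Fin N) ℂ) (specialUnitaryUnits (Fin N))) ops f b ιB C38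

/-- `Y9OfRecordUPb` unfolded (`rfl`). [cite: Balaban1985BackgroundPropagators, (3.35) p.396, bookkeeping] -/
theorem Y9OfRecordUPb_eq :
    Y9OfRecordUPb N θ Mstar ops f b ιB C38 = Y9OfRecordU N θ Mstar (extraYPb (Matrix (Fin N) (Fin N) ℂ) (specialUnitaryUnits (Fin N))) ops f b ιB C38 := rfl
/-- … through `carriersYU`. [cite: Balaban1985BackgroundPropagators, (3.35) p.396, bookkeeping] -/
theorem Y9OfRecordUPb_eq_carriersYU : Y9OfRecordUPb N θ Mstar ops f b ιB C38 =
    carriersYU (extraYPb (Matrix (Fin N) (Fin N) ℂ) (specialUnitaryUnits (Fin N))) (specialUnitaryUnits (Fin N)) f b ιB C38 ops := rfl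
/-- the index of the bundle is `J`. [cite: Balaban1985BackgroundPropagators, p.399, bookkeeping] -/
theorem Y9OfRecordUPb_I9 : (Y9OfRecordUPb N θ Mstar ops f b ιB C38).I9 = J := rfl
/-- … inhabited when `J` is. [cite: Balaban1985BackgroundPropagators, p.399, bookkeeping] -/
theorem Y9OfRecordUPb_nonempty_I9 [h : Nonempty J] : Nonempty (Y9OfRecordUPb N θ Mstar ops f b ιB C38).I9 := h
/-- **(3.35) of the bundle at the record's reading, at a base code, SPELLED OUT**: «`U` is `SU(N)`-valued», «`0 ≤ α₀`» and print's cube condition (3.35) at threshold `10` and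
`M·α₀` at the member's index, and MODULE 2-P's (3.35) at the second pin. [cite: Balaban1985BackgroundPropagators, (3.35) p.396 («|U(∂p) − 1| < α₀ M … O(1)»)] -/
theorem Y9OfRecordUPb_bg9_Reg335_base_iff (j : J) (c α₀ : ℝ) (U : CfgY (Matrix (Fin N) (Fin N) ℂ) (f j).toKIdx) :
    ((Y9OfRecordUPb N θ Mstar ops f b ιB C38).bg9 j).Reg335 c α₀ (.base U) ↔
      (GVal (specialUnitaryUnits (Fin N)) (f j).toKIdx U ∧
          (0 ≤ α₀ ∧ B9BackgroundsKLevelV1P.Reg335PC (Matrix (Fin N) (Fin N) ℂ) (f j).toKIdx (B9BackgroundsKLevelV1P.cubeClassP (f j).toKIdx c35Y)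
            ((B6KLevelCensusIndexV1.kGeo (f j).toKIdx).M * α₀) U)) ∧
        (bg9KP (Matrix (Fin N) (Fin N) ℂ) (specialUnitaryUnits (Fin N)) (f j).snd).Reg335 c35Y α₀ U := Iff.rfl
/-- **(3.36) of the bundle at the record's reading, at a base code, SPELLED OUT** likewise. [cite: Balaban1985BackgroundPropagators, (3.36) p.396] -/
theorem Y9OfRecordUPb_bg9_Reg336_base_iff (j : J) (c α₀ : ℝ) (U : CfgY (Matrix (Fin N) (Fin N) ℂ) (f j).toKIdx) :
    ((Y9OfRecordUPb N θ Mstar ops f b ιB C38).bg9 j).Reg336 c α₀ (.base U) ↔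
      (GVal (specialUnitaryUnits (Fin N)) (f j).toKIdx U ∧
          (0 ≤ α₀ ∧ B9BackgroundsKLevelV1P.Reg336PC (Matrix (Fin N) (Fin N) ℂ) (f j).toKIdx (B9BackgroundsKLevelV1P.cubeClassP (f j).toKIdx c35Y)
            ((B6KLevelCensusIndexV1.kGeo (f j).toKIdx).M * α₀) U)) ∧
        (bg9KP (Matrix (Fin N) (Fin N) ℂ) (specialUnitaryUnits (Fin N)) (f j).snd).Reg336 c35Y α₀ U := Iff.rfl
/-- the (3.35) family of the record's reading is `regYPb335` up to the order of conjuncts (dag-n06-c's `classIncl_regC335Pb_regYPb335`, re-read at the record's types).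
[cite: Balaban1985BackgroundPropagators, (3.35) p.396, bookkeeping] -/
theorem Y9OfRecordUPb_classIncl_regYPb335 (c c' : ℝ) :
    B9LeafXClassAntitone.ClassIncl (regC335 (Matrix (Fin N) (Fin N) ℂ) (specialUnitaryUnits (Fin N))
      (extraYPb (d := θ.d₆) (ℓ := θ.ℓ₆) (hd := θ.hd') (hL := θ.hL') (b₀ := θ.b₀) (b₁ := θ.b₁) (Mstar := Mstar) (Matrix (Fin N) (Fin N) ℂ) (specialUnitaryUnits (Fin N)))) c
      (B9BackgroundsKLevelV1Pb.regYPb335 (Matrix (Fin N) (Fin N) ℂ) (specialUnitaryUnits (Fin N))) c' :=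
  B9SectBCodedClassR.classIncl_regC335Pb_regYPb335 c c'
/-- the geometric fields of the bundle at the record's reading agree with `Y9OfRecordP`'s along `f` (`rfl`). [cite: Balaban1985BackgroundPropagators, Sect. A pp.396–397, bookkeeping] -/
theorem Y9OfRecordUPb_geo9 (j : J) : (Y9OfRecordUPb N θ Mstar ops f b ιB C38).geo9 j = (Y9OfRecordP N θ Mstar ops).geo9 (f j) := rfl

end Record

end Literature.MathematicalPhysics.QuantumFieldTheory.Balaban1983to89.Node00

end
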